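import Mathlib.Analysis.Calculus.ContDiff.Bounds
import Mathlib.Analysis.Calculus.FDeriv.Symmetric
import Mathlib.MeasureTheory.Integral.IntegralEqImproper
import Mathlib.MeasureTheory.Constructions.Pi
import Mathlib.MeasureTheory.Integral.Bochner.Basic
import Mathlib.MeasureTheory.Function.L1Space.Integrable
import Mathlib.Analysis.SpecialFunctions.SmoothTransition
import HarnessLib

/-!
# A Sobolev-type point bound on `ℝ^n`: the value at a point through mixed derivatives

The elementary embedding `W^{n,1} ↪ C⁰` at a point, on `ℝ^n = Fin n → ℝ` with Lebesgue measure,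
in the form needed to pass from the `L²`-interior estimate of
`Literature.Analysis.OperatorTheory.NelsonInteriorEstimate` to pointwise bounds:

* `lineD v w = Dw(·)[v]`, `mixedD n u = ∂_{n-1} ⋯ ∂_1 ∂_0 u` (a fold of coordinate line
  derivatives) and `nestD k w u` (nested coordinate derivatives of a word), with
  `nestD_eq_iteratedFDeriv` (`nestD k w u x = D^k u (x)(e_{w 0}, …, e_{w (k-1)})`),
  `mixedD_eq_nestD`, `norm_mixedD_le` (`‖mixedD n u x‖ ≤ ‖D^n u (x)‖`);
* `enorm_apply_zero_le_lintegral_mixedD` — **`‖u 0‖ ≤ ∫ ‖∂_{n-1} ⋯ ∂_0 u‖`** for smooth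
  compactly supported `u` (iterated fundamental theorem of calculus: the one-dimensional step
  `HasCompactSupport.integral_Iic_deriv_eq`, the slices `y ↦ ∂_0 u (t, y)`
  (`mixedD_succ_cons`), Tonelli and the measure-preserving splitting
  `MeasurableEquiv.piFinSuccAbove`);
* `exists_norm_mixedD_mul_le` — the Leibniz bound `‖mixedD n (θ F) x‖ ≤ C_θ ∑_{j ≤ n} ‖D^j F x‖`
  for a smooth compactly supported cut-off `θ` (Mathlib's `norm_iteratedFDeriv_mul_le`);
* `exists_norm_apply_zero_le_sum_setIntegral` — **the point bound**
  `‖F 0‖ ≤ C_θ ∑_{j ≤ n} ∫_{tsupport θ} ‖D^j F‖` for every smooth `F`, `θ(0) = 1`.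

Everything here is proved; the definitions are `lineD`, `mixedD`, `consZeroL`, `nestD`.

## References

* R. A. Adams, *Sobolev Spaces* (1975), Lemma 5.15 / Thm. 5.4 Part I Case C (`mp > n`; here
  the trivial case `m = n`, `p = 1`, smooth functions) [Adams1975].
* E. Nelson, *Analytic vectors*, Ann. of Math. 70 (1959), §6 (the passage from `L²`-bounds of
  all derivatives to pointwise bounds) [Nelson1959] (not held).
-/

open scoped ContDiff Topology ENNReal
open MeasureTheory Set Filter Finset

noncomputable section

namespace Literature.Analysis.OperatorTheory

/-! ## 1. Line derivatives along coordinate vectors and the mixed derivative -/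

section Mixed

variable {n : ℕ}

/-- The derivative along a fixed vector: `(lineD v w)(x) = Dw(x)[v]`. [folklore] -/
def lineD (v : Fin n → ℝ) (w : (Fin n → ℝ) → ℂ) (x : Fin n → ℝ) : ℂ := fderiv ℝ w x v

/-- `lineD` preserves smoothness. [folklore] -/
theorem contDiff_lineD (v : Fin n → ℝ) {w : (Fin n → ℝ) → ℂ} (hw : ContDiff ℝ ∞ w) :
    ContDiff ℝ ∞ (lineD v w) :=
  (hw.fderiv_right (m := ∞) (by norm_cast)).clm_apply contDiff_const

/-- `lineD` preserves compact support. [folklore] -/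
theorem hasCompactSupport_lineD (v : Fin n → ℝ) {w : (Fin n → ℝ) → ℂ} (hw : HasCompactSupport w) :
    HasCompactSupport (lineD v w) :=
  (hw.fderiv (𝕜 := ℝ)).comp_left (g := fun L : (Fin n → ℝ) →L[ℝ] ℂ ↦ L v) rfl

/-- Folding `lineD` over a list of coordinate directions preserves smoothness. [folklore] -/
theorem contDiff_foldl_lineD (l : List (Fin n)) {w : (Fin n → ℝ) → ℂ} (hw : ContDiff ℝ ∞ w) :
    ContDiff ℝ ∞ (l.foldl (fun w' i ↦ lineD (Pi.single i 1) w') w) := by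
  induction l generalizing w with
  | nil => simpa using hw
  | cons i l ih => exact ih (contDiff_lineD _ hw)

/-- Folding `lineD` preserves compact support. [folklore] -/
theorem hasCompactSupport_foldl_lineD (l : List (Fin n)) {w : (Fin n → ℝ) → ℂ}
    (hw : HasCompactSupport w) :
    HasCompactSupport (l.foldl (fun w' i ↦ lineD (Pi.single i 1) w') w) := by
  induction l generalizing w with
  | nil => simpa using hw
  | cons i l ih => exact ih (hasCompactSupport_lineD _ hw)

variable (n) in
/-- **The mixed derivative** `∂_{n-1} ⋯ ∂_1 ∂_0 u` of a function on `ℝ^n` (innermost `∂_0`).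
[folklore] -/
def mixedD (u : (Fin n → ℝ) → ℂ) : (Fin n → ℝ) → ℂ :=
  (List.finRange n).foldl (fun w i ↦ lineD (Pi.single i 1) w) u

/-- `mixedD` of a smooth function is smooth. [folklore] -/
theorem contDiff_mixedD {u : (Fin n → ℝ) → ℂ} (hu : ContDiff ℝ ∞ u) : ContDiff ℝ ∞ (mixedD n u) :=
  contDiff_foldl_lineD _ hu

/-- `mixedD` of a compactly supported function is compactly supported. [folklore] -/
theorem hasCompactSupport_mixedD {u : (Fin n → ℝ) → ℂ} (hu : HasCompactSupport u) :
    HasCompactSupport (mixedD n u) :=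
  hasCompactSupport_foldl_lineD _ hu

/-- Folding `lineD` does not increase the topological support. [folklore] -/
theorem tsupport_foldl_lineD_subset (l : List (Fin n)) (w : (Fin n → ℝ) → ℂ) :
    tsupport (l.foldl (fun w' i ↦ lineD (Pi.single i 1) w') w) ⊆ tsupport w := by
  induction l generalizing w with
  | nil => exact subset_rfl
  | cons i l ih => exact (ih _).trans (tsupport_fderiv_apply_subset ℝ (Pi.single i (1 : ℝ) : Fin n → ℝ))

/-- `tsupport (mixedD n u) ⊆ tsupport u`. [folklore] -/
theorem tsupport_mixedD_subset (u : (Fin n → ℝ) → ℂ) : tsupport (mixedD n u) ⊆ tsupport u :=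
  tsupport_foldl_lineD_subset _ u

/-! ### Slices `y ↦ w (t, y)` -/

/-- The linear embedding `y ↦ (0, y) : ℝ^n → ℝ^{n+1}`. [folklore] -/
def consZeroL : (Fin n → ℝ) →L[ℝ] (Fin (n + 1) → ℝ) :=
  LinearMap.toContinuousLinearMap
    { toFun := fun y ↦ Fin.cons 0 y
      map_add' := fun y y' ↦ by
        ext j
        refine Fin.cases ?_ (fun i ↦ ?_) j <;> simp
      map_smul' := fun c y ↦ by
        ext j
        refine Fin.cases ?_ (fun i ↦ ?_) j <;> simp }

/-- `consZeroL y = Fin.cons 0 y`. [folklore] -/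
@[simp] theorem consZeroL_apply (y : Fin n → ℝ) : consZeroL y = Fin.cons (0 : ℝ) y := rfl

/-- `Fin.cons t y = Fin.cons t 0 + (0, y)`. [folklore] -/
theorem cons_eq_add (t : ℝ) (y : Fin n → ℝ) :
    (Fin.cons t y : Fin (n + 1) → ℝ) = Fin.cons t (0 : Fin n → ℝ) + consZeroL y := by
  ext j
  refine Fin.cases ?_ (fun i ↦ ?_) j <;> simp

/-- `(0, e_i) = e_{i+1}`. [folklore] -/
theorem cons_zero_single (i : Fin n) :
    (Fin.cons (0 : ℝ) (Pi.single i (1 : ℝ)) : Fin (n + 1) → ℝ) = Pi.single i.succ 1 := by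
  ext j
  refine Fin.cases ?_ (fun k ↦ ?_) j
  · simp
  · simp [Pi.single_apply]

/-- `Fin.cons t 0 = t • e_0`. [folklore] -/
theorem cons_zero_eq_smul_single (t : ℝ) :
    (Fin.cons t (0 : Fin n → ℝ) : Fin (n + 1) → ℝ) = t • Pi.single (0 : Fin (n + 1)) (1 : ℝ) := by
  ext j
  refine Fin.cases ?_ (fun k ↦ ?_) j
  · simp
  · simp [Fin.succ_ne_zero]

/-- `‖y‖ ≤ ‖(t, y)‖` (sup norm). [folklore] -/
theorem norm_le_norm_cons (t : ℝ) (y : Fin n → ℝ) : ‖y‖ ≤ ‖(Fin.cons t y : Fin (n + 1) → ℝ)‖ := by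
  refine (pi_norm_le_iff_of_nonneg (norm_nonneg _)).2 fun i ↦ ?_
  have := norm_le_pi_norm (Fin.cons t y : Fin (n + 1) → ℝ) i.succ
  simpa using this

/-- **Chain rule for slices**: `∂'_i (w ∘ (t, ·))(y) = ∂_{i+1} w (t, y)`. [folklore] -/
theorem lineD_comp_cons {w : (Fin (n + 1) → ℝ) → ℂ} (hw : Differentiable ℝ w) (t : ℝ) (i : Fin n) :
    lineD (Pi.single i 1) (fun y ↦ w (Fin.cons t y)) =
      fun y ↦ lineD (Pi.single i.succ 1) w (Fin.cons t y) := by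
  funext y
  have hι : HasFDerivAt (fun y : Fin n → ℝ ↦ (Fin.cons t y : Fin (n + 1) → ℝ)) consZeroL y := by
    have h : (fun y : Fin n → ℝ ↦ (Fin.cons t y : Fin (n + 1) → ℝ)) =
        fun y ↦ Fin.cons t (0 : Fin n → ℝ) + consZeroL y := by
      funext y; exact cons_eq_add t y
    rw [h]
    exact (consZeroL.hasFDerivAt).const_add _
  have hc : fderiv ℝ (fun y ↦ w (Fin.cons t y)) y = (fderiv ℝ w (Fin.cons t y)).comp consZeroL :=
    ((hw (Fin.cons t y)).hasFDerivAt.comp y hι).fderiv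
  rw [lineD, hc, lineD]
  simp only [ContinuousLinearMap.coe_comp, Function.comp_apply, consZeroL_apply, cons_zero_single]

/-- **Slices of folded line derivatives**: folding `∂'_i` over `l` on the slice `y ↦ w (t, y)` is
the slice of folding `∂_{i+1}` over `l` on `w`. [folklore] -/
theorem foldl_lineD_comp_cons (l : List (Fin n)) {w : (Fin (n + 1) → ℝ) → ℂ} (hw : ContDiff ℝ ∞ w)
    (t : ℝ) :
    l.foldl (fun w' i ↦ lineD (Pi.single i 1) w') (fun y ↦ w (Fin.cons t y)) =
      fun y ↦ (l.map Fin.succ).foldl (fun w' j ↦ lineD (Pi.single j 1) w') w (Fin.cons t y) := by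
  induction l generalizing w with
  | nil => rfl
  | cons i l ih =>
    simp only [List.foldl_cons, List.map_cons]
    rw [lineD_comp_cons (hw.differentiable (by simp)) t i]
    exact ih (contDiff_lineD _ hw)

/-- `mixedD (n+1) u (t, y) = mixedD n (y ↦ ∂_0 u (t, y)) y`. [folklore] -/
theorem mixedD_succ_cons {u : (Fin (n + 1) → ℝ) → ℂ} (hu : ContDiff ℝ ∞ u) (t : ℝ) (y : Fin n → ℝ) :
    mixedD (n + 1) u (Fin.cons t y) =
      mixedD n (fun y' ↦ lineD (Pi.single 0 1) u (Fin.cons t y')) y := by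
  have h := foldl_lineD_comp_cons (List.finRange n) (contDiff_lineD (Pi.single 0 1) hu) t
  have h' := congr_fun h y
  rw [mixedD, mixedD, List.finRange_succ, List.foldl_cons, List.foldl_map]
  simp only [List.foldl_map] at h'
  exact h'.symm

/-! ### The one-dimensional step -/

/-- **`‖g 0‖ ≤ ∫ ‖g'‖`** for `g : ℝ → ℂ` of class `C¹` with compact support, in `ℝ≥0∞` form.
[folklore] -/
theorem enorm_apply_zero_le_lintegral_deriv {g : ℝ → ℂ} (hg : ContDiff ℝ 1 g) (hgc : HasCompactSupport g) :
    ‖g 0‖ₑ ≤ ∫⁻ t, ‖deriv g t‖ₑ := by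
  have hderc : Continuous (deriv g) := hg.continuous_deriv le_rfl
  have hders : HasCompactSupport (deriv g) := hgc.deriv
  have hint : Integrable (deriv g) := hderc.integrable_of_hasCompactSupport hders
  have h1 : g 0 = ∫ t in Iic 0, deriv g t := (hgc.integral_Iic_deriv_eq hg 0).symm
  have h2 : ‖g 0‖ ≤ ∫ t, ‖deriv g t‖ := by
    rw [h1]
    refine (norm_integral_le_integral_norm _).trans ?_
    exact setIntegral_le_integral hint.norm (Eventually.of_forall fun t ↦ norm_nonneg _)
  rw [← ofReal_norm, ← ofReal_integral_norm_eq_lintegral_enorm hint]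
  exact ENNReal.ofReal_le_ofReal h2

/-- The slice `t ↦ u (t, 0)` has derivative `∂_0 u (t, 0)`. [folklore] -/
theorem deriv_comp_cons_zero {u : (Fin (n + 1) → ℝ) → ℂ} (hu : Differentiable ℝ u) (t : ℝ) :
    deriv (fun s : ℝ ↦ u (Fin.cons s (0 : Fin n → ℝ))) t =
      lineD (Pi.single (0 : Fin (n + 1)) (1 : ℝ)) u (Fin.cons t (0 : Fin n → ℝ)) := by
  have hι : HasDerivAt (fun s : ℝ ↦ (Fin.cons s (0 : Fin n → ℝ) : Fin (n + 1) → ℝ))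
      (Pi.single (0 : Fin (n + 1)) (1 : ℝ)) t := by
    have h : (fun s : ℝ ↦ (Fin.cons s (0 : Fin n → ℝ) : Fin (n + 1) → ℝ)) =
        fun s ↦ s • Pi.single (0 : Fin (n + 1)) (1 : ℝ) := by
      funext s; exact cons_zero_eq_smul_single s
    rw [h]
    simpa using (hasDerivAt_id t).smul_const (Pi.single (0 : Fin (n + 1)) (1 : ℝ) : Fin (n + 1) → ℝ)
  exact ((hu _).hasFDerivAt.comp_hasDerivAt t hι).deriv

/-! ### The point bound through the mixed derivative -/

/-- **`‖u 0‖ ≤ ∫ ‖∂_{n-1} ⋯ ∂_0 u‖` for smooth compactly supported `u` on `ℝ^n`** (iterated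
fundamental theorem of calculus; induction on `n` through the measure-preserving splitting
`ℝ^{n+1} ≃ ℝ × ℝ^n` and Tonelli). This is the embedding `W^{n,1} ↪ C⁰` at a point. [folklore] -/
theorem enorm_apply_zero_le_lintegral_mixedD :
    ∀ (n : ℕ) (u : (Fin n → ℝ) → ℂ), ContDiff ℝ ∞ u → HasCompactSupport u →
      ‖u 0‖ₑ ≤ ∫⁻ x, ‖mixedD n u x‖ₑ := by
  intro n
  induction n with
  | zero =>
    intro u hu _
    have hvol : (volume : Measure (Fin 0 → ℝ)) = Measure.dirac 0 := by
      rw [volume_pi, Measure.pi_of_empty _ 0]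
    rw [hvol, lintegral_dirac]
    simp [mixedD]
  | succ n ih =>
    intro u hu huc
    -- the slices `s_t (y) = ∂_0 u (t, y)`
    set s : ℝ → (Fin n → ℝ) → ℂ := fun t y ↦ lineD (Pi.single 0 1) u (Fin.cons t y) with hs
    have hD : ContDiff ℝ ∞ (lineD (Pi.single (0 : Fin (n + 1)) 1) u) := contDiff_lineD _ hu
    have hDc : HasCompactSupport (lineD (Pi.single (0 : Fin (n + 1)) 1) u) := hasCompactSupport_lineD _ huc
    have hcons : ∀ t : ℝ, ContDiff ℝ ∞ fun y : Fin n → ℝ ↦ (Fin.cons t y : Fin (n + 1) → ℝ) := fun t ↦ by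
      have h : (fun y : Fin n → ℝ ↦ (Fin.cons t y : Fin (n + 1) → ℝ)) =
          fun y ↦ Fin.cons t (0 : Fin n → ℝ) + consZeroL y := by
        funext y; exact cons_eq_add t y
      rw [h]
      exact contDiff_const.add consZeroL.contDiff
    have hss : ∀ t, ContDiff ℝ ∞ (s t) := fun t ↦ hD.comp (hcons t)
    obtain ⟨R, hR⟩ := huc.isCompact.isBounded.subset_closedBall 0
    have hsc : ∀ t, HasCompactSupport (s t) := by
      intro t
      refine HasCompactSupport.of_support_subset_isCompact (isCompact_closedBall (0 : Fin n → ℝ) R) ?_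
      intro y hy
      have h1 : (Fin.cons t y : Fin (n + 1) → ℝ) ∈ tsupport u := by
        have : (Fin.cons t y : Fin (n + 1) → ℝ) ∈ Function.support (lineD (Pi.single (0 : Fin (n + 1)) 1) u) := hy
        exact tsupport_fderiv_apply_subset ℝ (Pi.single (0 : Fin (n + 1)) (1 : ℝ) : Fin (n + 1) → ℝ) (subset_closure this)
      have h2 := hR h1
      rw [mem_closedBall_zero_iff] at h2 ⊢
      exact (norm_le_norm_cons t y).trans h2
    -- (1) the one-dimensional step along `t ↦ u (t, 0)`
    have hline : ContDiff ℝ ∞ fun t : ℝ ↦ (Fin.cons t (0 : Fin n → ℝ) : Fin (n + 1) → ℝ) := by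
      have h : (fun t : ℝ ↦ (Fin.cons t (0 : Fin n → ℝ) : Fin (n + 1) → ℝ)) =
          fun t ↦ t • Pi.single (0 : Fin (n + 1)) (1 : ℝ) := by
        funext t; exact cons_zero_eq_smul_single t
      rw [h]
      exact contDiff_id.smul contDiff_const
    set g : ℝ → ℂ := fun t ↦ u (Fin.cons t (0 : Fin n → ℝ)) with hg
    have hgs : ContDiff ℝ 1 g :=
      (hu.of_le (by exact_mod_cast le_top)).comp (hline.of_le (by exact_mod_cast le_top))
    have hgc : HasCompactSupport g := by
      refine HasCompactSupport.of_support_subset_isCompact (isCompact_closedBall (0 : ℝ) R) ?_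
      intro t ht
      have h1 : (Fin.cons t (0 : Fin n → ℝ) : Fin (n + 1) → ℝ) ∈ tsupport u := subset_closure ht
      have h2 := hR h1
      rw [mem_closedBall_zero_iff] at h2 ⊢
      have h3 := norm_le_pi_norm (Fin.cons t (0 : Fin n → ℝ) : Fin (n + 1) → ℝ) 0
      rw [Fin.cons_zero] at h3
      exact h3.trans h2
    have hzero : (Fin.cons (0 : ℝ) (0 : Fin n → ℝ) : Fin (n + 1) → ℝ) = 0 := by
      rw [cons_zero_eq_smul_single, zero_smul]
    have h1D : ‖u 0‖ₑ ≤ ∫⁻ t, ‖s t 0‖ₑ := by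
      have h0 : u 0 = g 0 := by simp only [hg, hzero]
      have hderiv : ∀ t, deriv g t = s t 0 := fun t ↦ deriv_comp_cons_zero (hu.differentiable (by simp)) t
      calc ‖u 0‖ₑ = ‖g 0‖ₑ := by rw [h0]
        _ ≤ ∫⁻ t, ‖deriv g t‖ₑ := enorm_apply_zero_le_lintegral_deriv hgs hgc
        _ = ∫⁻ t, ‖s t 0‖ₑ := by simp only [hderiv]
    -- (2) the induction hypothesis on each slice
    have h2 : ∫⁻ t, ‖s t 0‖ₑ ≤ ∫⁻ t, ∫⁻ y, ‖mixedD n (s t) y‖ₑ :=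
      lintegral_mono fun t ↦ ih (s t) (hss t) (hsc t)
    -- (3) Tonelli and the splitting `ℝ^{n+1} ≃ ℝ × ℝ^n`
    have hmeas : Measurable fun x : Fin (n + 1) → ℝ ↦ ‖mixedD (n + 1) u x‖ₑ :=
      (contDiff_mixedD hu).continuous.measurable.enorm
    have h3 : ∫⁻ t, ∫⁻ y, ‖mixedD n (s t) y‖ₑ = ∫⁻ x, ‖mixedD (n + 1) u x‖ₑ := by
      have e1 : ∀ t y, mixedD n (s t) y = mixedD (n + 1) u (Fin.cons t y) := fun t y ↦
        (mixedD_succ_cons hu t y).symm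
      simp_rw [e1]
      have hmp := (volume_preserving_piFinSuccAbove (fun _ : Fin (n + 1) ↦ ℝ) 0).symm
      rw [← hmp.lintegral_comp hmeas, Measure.volume_eq_prod,
        lintegral_prod (fun a : ℝ × (Fin n → ℝ) ↦
          ‖mixedD (n + 1) u ((MeasurableEquiv.piFinSuccAbove (fun _ : Fin (n + 1) ↦ ℝ) 0).symm a)‖ₑ)
          (hmeas.comp hmp.measurable).aemeasurable]
      refine lintegral_congr fun t ↦ lintegral_congr fun y ↦ ?_
      congr 2
      simp [MeasurableEquiv.piFinSuccAbove_symm_apply]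
      rfl
    exact h1D.trans (h2.trans h3.le)


/-! ## 2. Nested coordinate derivatives and the iterated Fréchet derivative -/

/-- The nested coordinate derivative `∂_{w 0} (∂_{w 1} (⋯ ∂_{w (k-1)} u))` of a word
`w : Fin k → Fin n` (the letter `w 0` outermost). [folklore] -/
def nestD : (k : ℕ) → (Fin k → Fin n) → ((Fin n → ℝ) → ℂ) → ((Fin n → ℝ) → ℂ)
  | 0, _, u => u
  | k + 1, w, u => lineD (Pi.single (w 0) 1) (nestD k (Fin.tail w) u)

/-- `nestD` of a smooth function is smooth. [folklore] -/
theorem contDiff_nestD : ∀ (k : ℕ) (w : Fin k → Fin n) {u : (Fin n → ℝ) → ℂ}, ContDiff ℝ ∞ u →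
    ContDiff ℝ ∞ (nestD k w u) := by
  intro k
  induction k with
  | zero => intro w u hu; exact hu
  | succ k ih => intro w u hu; exact contDiff_lineD _ (ih (Fin.tail w) hu)

/-- **Nested coordinate derivatives are evaluations of the iterated Fréchet derivative**:
`nestD k w u x = D^k u (x) (e_{w 0}, …, e_{w (k-1)})`. [folklore] -/
theorem nestD_eq_iteratedFDeriv : ∀ (k : ℕ) (w : Fin k → Fin n) {u : (Fin n → ℝ) → ℂ},
    ContDiff ℝ ∞ u → ∀ x, nestD k w u x =
      iteratedFDeriv ℝ k u x (fun j ↦ (Pi.single (w j) (1 : ℝ) : Fin n → ℝ)) := by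
  intro k
  induction k with
  | zero => intro w u _ x; simp [nestD]
  | succ k ih =>
    intro w u hu x
    have hfun : nestD k (Fin.tail w) u =
        fun y ↦ iteratedFDeriv ℝ k u y (fun j ↦ (Pi.single (Fin.tail w j) (1 : ℝ) : Fin n → ℝ)) :=
      funext (ih (Fin.tail w) hu)
    have hd : DifferentiableAt ℝ (iteratedFDeriv ℝ k u) x :=
      hu.differentiable_iteratedFDeriv (m := k) (by exact_mod_cast ENat.coe_lt_top k) x
    rw [nestD, lineD, hfun, fderiv_continuousMultilinear_apply_const_apply hd,
      iteratedFDeriv_succ_apply_left]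
    rfl

/-- `‖nestD k w u x‖ ≤ ‖D^k u (x)‖` (the coordinate vectors have norm `1`). [folklore] -/
theorem norm_nestD_le (k : ℕ) (w : Fin k → Fin n) {u : (Fin n → ℝ) → ℂ} (hu : ContDiff ℝ ∞ u)
    (x : Fin n → ℝ) : ‖nestD k w u x‖ ≤ ‖iteratedFDeriv ℝ k u x‖ := by
  rw [nestD_eq_iteratedFDeriv k w hu x]
  refine (ContinuousMultilinearMap.le_opNorm _ _).trans ?_
  have : ∏ j : Fin k, ‖(Pi.single (w j) (1 : ℝ) : Fin n → ℝ)‖ = 1 := by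
    simp [Pi.norm_single]
  rw [this, mul_one]

/-- Folding `lineD` over `List.ofFn w` is the nested derivative of the reversed word. [folklore] -/
theorem foldl_ofFn_eq_nestD : ∀ (k : ℕ) (w : Fin k → Fin n) (u : (Fin n → ℝ) → ℂ),
    (List.ofFn w).foldl (fun w' i ↦ lineD (Pi.single i 1) w') u = nestD k (w ∘ Fin.rev) u := by
  intro k
  induction k with
  | zero => intro w u; rfl
  | succ k ih =>
    intro w u
    rw [List.ofFn_succ', List.concat_eq_append, List.foldl_append, ih]
    have hw : ((fun i : Fin k ↦ w (Fin.castSucc i)) ∘ Fin.rev) = Fin.tail (w ∘ Fin.rev) := by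
      funext j
      simp only [Function.comp_apply, Fin.tail, Fin.rev_succ]
    rw [hw]
    simp only [List.foldl_cons, List.foldl_nil, nestD, Function.comp_apply, Fin.rev_zero]

/-- The mixed derivative is the nested derivative of the word `(n-1, …, 1, 0)`. [folklore] -/
theorem mixedD_eq_nestD (u : (Fin n → ℝ) → ℂ) : mixedD n u = nestD n Fin.rev u := by
  rw [mixedD, ← List.ofFn_id, foldl_ofFn_eq_nestD]
  rfl

/-- **`‖mixedD n u x‖ ≤ ‖D^n u (x)‖`.** [folklore] -/
theorem norm_mixedD_le {u : (Fin n → ℝ) → ℂ} (hu : ContDiff ℝ ∞ u) (x : Fin n → ℝ) :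
    ‖mixedD n u x‖ ≤ ‖iteratedFDeriv ℝ n u x‖ := by
  rw [mixedD_eq_nestD]
  exact norm_nestD_le n _ hu x

/-- **Leibniz bound for a cut-off product.** For `θ` smooth with compact support there is
`C ≥ 0` such that for every smooth `F` and every `x`,
`‖mixedD n (θ · F) x‖ ≤ C ∑_{j ≤ n} ‖D^j F (x)‖` (and the left side vanishes off the support of
`θ`). [folklore] -/
theorem exists_norm_mixedD_mul_le {θ : (Fin n → ℝ) → ℝ} (hθ : ContDiff ℝ ∞ θ) (hθc : HasCompactSupport θ) :
    ∃ C : ℝ, 0 ≤ C ∧ ∀ (F : (Fin n → ℝ) → ℂ), ContDiff ℝ ∞ F → ∀ x,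
      ‖mixedD n (fun y ↦ ((θ y : ℝ) : ℂ) * F y) x‖ ≤
        C * ∑ j ∈ Finset.range (n + 1), ‖iteratedFDeriv ℝ j F x‖ := by
  set θc : (Fin n → ℝ) → ℂ := fun y ↦ ((θ y : ℝ) : ℂ) with hθc'
  have hθs : ContDiff ℝ ∞ θc := Complex.ofRealCLM.contDiff.comp hθ
  have hθcs : HasCompactSupport θc := hθc.comp_left Complex.ofReal_zero
  -- uniform bound of the derivatives of `θc` of order `≤ n`
  have hB : ∀ i : ℕ, ∃ B, ∀ x, ‖iteratedFDeriv ℝ i θc x‖ ≤ B := fun i ↦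
    (hθs.continuous_iteratedFDeriv (m := i) (by exact_mod_cast le_top)).bounded_above_of_compact_support
      (hθcs.iteratedFDeriv (𝕜 := ℝ) i)
  choose B hB using hB
  set Bm : ℝ := ∑ i ∈ Finset.range (n + 1), max (B i) 0 with hBm
  have hBm0 : 0 ≤ Bm := Finset.sum_nonneg fun i _ ↦ le_max_right _ _
  have hBi : ∀ i ∈ Finset.range (n + 1), ∀ x, ‖iteratedFDeriv ℝ i θc x‖ ≤ Bm := fun i hi x ↦
    (hB i x).trans ((le_max_left _ _).trans
      (Finset.single_le_sum (f := fun i ↦ max (B i) 0) (fun i _ ↦ le_max_right _ _) hi))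
  refine ⟨Bm * ∑ i ∈ Finset.range (n + 1), (n.choose i : ℝ), by positivity, fun F hF x ↦ ?_⟩
  have hsum0 : 0 ≤ ∑ j ∈ Finset.range (n + 1), ‖iteratedFDeriv ℝ j F x‖ :=
    Finset.sum_nonneg fun j _ ↦ norm_nonneg _
  calc ‖mixedD n (fun y ↦ θc y * F y) x‖ ≤ ‖iteratedFDeriv ℝ n (fun y ↦ θc y * F y) x‖ :=
        norm_mixedD_le (hθs.mul hF) x
    _ ≤ ∑ i ∈ Finset.range (n + 1), (n.choose i : ℝ) * ‖iteratedFDeriv ℝ i θc x‖ *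
          ‖iteratedFDeriv ℝ (n - i) F x‖ := norm_iteratedFDeriv_mul_le hθs hF x (by exact_mod_cast le_top)
    _ ≤ ∑ i ∈ Finset.range (n + 1), (n.choose i : ℝ) * Bm *
          ∑ j ∈ Finset.range (n + 1), ‖iteratedFDeriv ℝ j F x‖ := by
        refine Finset.sum_le_sum fun i hi ↦ ?_
        refine mul_le_mul (mul_le_mul_of_nonneg_left (hBi i hi x) (by positivity)) ?_ (norm_nonneg _)
          (by positivity)
        exact Finset.single_le_sum (f := fun j ↦ ‖iteratedFDeriv ℝ j F x‖) (fun j _ ↦ norm_nonneg _)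
          (Finset.mem_range.2 (by omega))
    _ = _ := by rw [← Finset.sum_mul, ← Finset.sum_mul]; ring


/-! ## 3. The point bound through derivatives on the support of a cut-off -/

/-- **The Sobolev point bound.** Let `θ` be a smooth compactly supported function on `ℝ^n`
with `θ(0) = 1`. There is `C ≥ 0` such that for every smooth `F : ℝ^n → ℂ`,

  `‖F 0‖ ≤ C ∑_{j ≤ n} ∫_{tsupport θ} ‖D^j F (x)‖ dx`

(`‖(θF)(0)‖ ≤ ∫ ‖∂_{n-1} ⋯ ∂_0 (θ F)‖` by `enorm_apply_zero_le_lintegral_mixedD`, and the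
Leibniz bound `exists_norm_mixedD_mul_le`). This is the embedding `W^{n,1} ↪ C⁰` at a point,
localised. [folklore] -/
theorem exists_norm_apply_zero_le_sum_setIntegral {θ : (Fin n → ℝ) → ℝ} (hθ : ContDiff ℝ ∞ θ)
    (hθc : HasCompactSupport θ) (hθ0 : θ 0 = 1) :
    ∃ C : ℝ, 0 ≤ C ∧ ∀ (F : (Fin n → ℝ) → ℂ), ContDiff ℝ ∞ F →
      ‖F 0‖ ≤ C * ∑ j ∈ Finset.range (n + 1), ∫ x in tsupport θ, ‖iteratedFDeriv ℝ j F x‖ := by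
  obtain ⟨C, hC0, hC⟩ := exists_norm_mixedD_mul_le hθ hθc
  refine ⟨C, hC0, fun F hF ↦ ?_⟩
  set u : (Fin n → ℝ) → ℂ := fun y ↦ ((θ y : ℝ) : ℂ) * F y with hu
  have hus : ContDiff ℝ ∞ u := (Complex.ofRealCLM.contDiff.comp hθ).mul hF
  have hθcs : HasCompactSupport fun y : Fin n → ℝ ↦ ((θ y : ℝ) : ℂ) := hθc.comp_left Complex.ofReal_zero
  have huc : HasCompactSupport u := hθcs.mul_right
  have hK : IsCompact (tsupport θ) := hθc
  have htu : tsupport u ⊆ tsupport θ := by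
    refine closure_minimal (fun x hx ↦ subset_closure ?_) (isClosed_tsupport _)
    intro h0
    exact hx (by simp [hu, h0])
  -- (1) the mixed-derivative bound, as a real integral
  have h1 := enorm_apply_zero_le_lintegral_mixedD n u hus huc
  have hmc : Continuous (mixedD n u) := (contDiff_mixedD hus).continuous
  have hmi : Integrable (mixedD n u) := hmc.integrable_of_hasCompactSupport (hasCompactSupport_mixedD huc)
  have hu0 : u 0 = F 0 := by simp [hu, hθ0]
  have h2 : ‖F 0‖ ≤ ∫ x, ‖mixedD n u x‖ := by
    rw [← hu0]
    have h := h1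
    rw [← ofReal_integral_norm_eq_lintegral_enorm hmi, ← ofReal_norm,
      ENNReal.ofReal_le_ofReal_iff (integral_nonneg fun x ↦ norm_nonneg _)] at h
    exact h
  -- (2) pointwise bound by derivatives of `F`, supported in `tsupport θ`
  set g : (Fin n → ℝ) → ℝ := fun x ↦ C * ∑ j ∈ Finset.range (n + 1), ‖iteratedFDeriv ℝ j F x‖ with hg
  have hgc : Continuous g := continuous_const.mul (continuous_finsetSum _ fun j _ ↦
    (hF.continuous_iteratedFDeriv (m := j) (by exact_mod_cast le_top)).norm)
  have h3 : ∀ x, ‖mixedD n u x‖ ≤ (tsupport θ).indicator g x := by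
    intro x
    by_cases hx : x ∈ tsupport θ
    · rw [indicator_of_mem hx]
      exact hC F hF x
    · rw [indicator_of_notMem hx]
      have hx' : x ∉ tsupport (mixedD n u) := fun h ↦ hx (htu (tsupport_mixedD_subset u h))
      rw [image_eq_zero_of_notMem_tsupport hx', norm_zero]
  have hgi : Integrable ((tsupport θ).indicator g) :=
    (integrable_indicator_iff (isClosed_tsupport _).measurableSet).2 (hgc.continuousOn.integrableOn_compact hK)
  -- (3) integrate
  calc ‖F 0‖ ≤ ∫ x, ‖mixedD n u x‖ := h2
    _ ≤ ∫ x, (tsupport θ).indicator g x := integral_mono hmi.norm hgi h3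
    _ = ∫ x in tsupport θ, g x := integral_indicator (isClosed_tsupport _).measurableSet
    _ = C * ∑ j ∈ Finset.range (n + 1), ∫ x in tsupport θ, ‖iteratedFDeriv ℝ j F x‖ := by
        rw [hg, integral_const_mul, integral_finsetSum]
        intro j _
        exact ((hF.continuous_iteratedFDeriv (m := j) (by exact_mod_cast le_top)).norm).continuousOn.integrableOn_compact hK

end Mixed

end Literature.Analysis.OperatorTheory
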